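import Literature.NumberTheory.Rogawski1990.ArchOrbitalIntegralContinuityPlaces    -- ★ (W1-cont-Π) §1: `uniformlyProper_centralizer_map_of_diag_hyperbolic` (split Cartan of `U(Φ₃)(ℂ)` through any frame); `uniformlyProper_comp`
import Literature.NumberTheory.Rogawski1990.ArchInnerFormSemiregularProperSplit     -- ★ p850330 (J-DESC) D4b-1β (+ D4b-1, D4a, atlas: `cayB`, `boostStd_mul_cayB`, `gprimeSplitMatrix`, `gprimeBlock`, `splitChartPlaces`)
import Literature.NumberTheory.Automorphic.UnitaryGroupFormTransport                -- ★ `unitaryGroupOfFormCongrOfEq` (`g ↦ T g T⁻¹`), `unitaryGroupOfFormReindex` (`g ↦ reindex τ τ g`)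
import HarnessLib

/-!
# (HYP) for the split block chart at its REGULAR points — the `hsplit` binder of ★ D4b-1 ∕ D4b-1β discharged

Registry: pub-hodgecm `F0/P3c/LH3` dealer board, organ **(J-DESC)** brick **(SPLIT-DOCK)** for crux H413 (`stmt-HodgeConjecture-24833`,
line `F0_P3c_StubN9Direct`, closer stub `stub_N9`).  THEOREMS ONLY.

★ D4b-1 `uniformlyProper_gprimeTorus_of_semireg` and ★ D4b-1β `uniformlyProper_gprimeTorus_of_semireg_split` carry, at the split-chart places
`w ∈ S♯ ∩ splitChartPlaces` (other than the wall place), the per-place hypothesis `hsplit`: the block chart `cw ↦ gprimeBlock α w S♯ (fun _ ↦ cw)` is uniformly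
proper modulo `Z(gprimeBlock α w S♯ p)`.  This file PROVES it on `{cw | cw 0 ≠ 0}` (the `w`-factor of ★ `ArchCartan.RegG S♯`) whenever `p w 0 ≠ 0`, by docking
★ (W1-cont-Π) `uniformlyProper_centralizer_map_of_diag_hyperbolic` (the compactness lemma for the split Cartan of the model group `U(Φ₃)(ℂ)`, `Φ₃ = antidiag(1,1,1)`,
through ANY bicontinuous frame `e : U(Φ₃)(ℂ) ≃* G′_w`) along the BOOST FRAME of the atlas:
* §1 `formCongr_boostFrame_eq_smul_antidiag`: `T̄ᵀ · diag(b) · T = b₁ • Φ₃` for `T = cayB b · diag(1, 1, −b₁∕(2b₂))` (`b = a ∘ τ`, `b₀b₂ < 0`);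
  `boostFrame_conj_diagonal`: `T · diag(boostEig c) · T⁻¹ = boostStd b c`; `unitaryGroupOfForm_smul`: `U(εJ) = U(J)`;
  `mem_unitaryGroupOfForm_antidiag_of_coe_eq_diagonal_boostEig`: `diag(boostEig c) ∈ U(Φ₃)(ℂ)`.
* §2 `uniformlyProper_of_frame_diag_boostEig` (frame-generic, `L`-free): `e` bicontinuous, `c` continuous with `e⁻¹(c cw) = diag(boostEig cw)` ⇒ `c` is uniformly
  proper modulo `Z(c p)` on `{cw 0 ≠ 0}` for `p 0 ≠ 0` (★ §1 of (W1-cont-Π) + ★ `uniformlyProper_comp`).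
* §3 **`uniformlyProper_gprimeBlock_split_of_ne_zero`** — the `hsplit` binder verbatim, via the frame
  `U(Φ₃) = U(b₁Φ₃) ≃[T] U(diag b) = U((diag a).submatrix τ τ) ≃[reindex τ] U(diag a) = G′_w`.
* §4 the atlas: `symm_archPiEquivCM_mem_centralizer_gprimeTorus_iff` (`Z(gprimeTorus p) = Π_w Z(gprimeBlock p w)`), **`uniformlyProper_gprimeTorus_of_regular`** (no wall) and
  its group-level form `exists_isCompact_mul_gprimeTorus_of_regular` (the `hCM` binder of ★ D4b-2 on `RegG S♯`), and ★ D4b-1 ∕ D4b-1β with `hsplit` discharged: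
  `uniformlyProper_gprimeTorus_of_semireg_of_regular`, `uniformlyProper_gprimeTorus_of_semireg_split_of_regular`.

References: Rogawski 1990, §3.6 p. 31, §4.12 Lemma 4.12.1 p. 66, §8.2 pp. 114, 122–123; Harish-Chandra 1970 (LNM 162), Part I §3 Lemma 22; Knapp 1986, Ch. V §3;
Platonov–Rapinchuk 1994, §2.3 (equivalent forms give conjugate groups).
-/

noncomputable section

open MeasureTheory Set Topology NumberField NumberField.InfinitePlace Matrix Complex
open Literature.MeasureTheory.Group Literature.NumberTheory.Automorphic Literature.NumberTheory.Automorphic.UnitaryGroup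
open scoped MatrixGroups Matrix Pointwise ComplexConjugate

namespace Literature.NumberTheory.Rogawski1990

/-! ## §1 The boost frame: Gram matrix, conjugation identity, membership of the eigenvalue diagonal -/

section Frame

/-- `U(σ, ε • J) = U(σ, J)` for a nonzero scalar `ε`. [cite: PlatonovRapinchuk1994, §2.3] -/
theorem unitaryGroupOfForm_smul {R : Type*} [Field R] {n : Type*} [Fintype n] [DecidableEq n] (σ : R →+* R) (J : Matrix n n R)
    {ε : R} (hε : ε ≠ 0) : unitaryGroupOfForm σ (ε • J) = unitaryGroupOfForm σ J := by
  ext g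
  rw [mem_unitaryGroupOfForm_iff, mem_unitaryGroupOfForm_iff, Matrix.mul_smul, Matrix.smul_mul]
  exact (smul_right_injective _ hε).eq_iff

variable {b : Fin 3 → ℝ}

/-- `r² b₀ = −b₂` for `r = √(−b₂∕b₀)`, `b₀ b₂ < 0` (as a complex identity). [cite: Knapp1986, Ch. V §3] -/
theorem sqrt_ratio_mul_self_mul (hb : b 0 * b 2 < 0) :
    (Real.sqrt (-b 2 / b 0) : ℂ) * (Real.sqrt (-b 2 / b 0) : ℂ) * (b 0 : ℂ) = -(b 2 : ℂ) := by
  have hb0 : b 0 ≠ 0 := fun h => by rw [h, zero_mul] at hb; exact lt_irrefl _ hb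
  have hnn : 0 ≤ -b 2 / b 0 := by
    have : -b 2 / b 0 = -(b 0 * b 2) / (b 0 * b 0) := by field_simp
    rw [this]; exact div_nonneg (by linarith) (mul_self_nonneg _)
  have hr : Real.sqrt (-b 2 / b 0) * Real.sqrt (-b 2 / b 0) * b 0 = -b 2 := by
    rw [Real.mul_self_sqrt hnn]; field_simp
  exact_mod_cast hr

/-- **Gram matrix of the scaled boost frame**: for `T = cayB b · diag(1, 1, −b₁∕(2b₂))`, `T̄ᵀ · diag(b) · T = b₁ • Φ₃` (`Φ₃ = antidiag(1,1,1)`), `b₀ b₂ < 0`.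
[cite: Knapp1986, Ch. V §3] [cite: PlatonovRapinchuk1994, §2.3] -/
theorem formCongr_boostFrame_eq_smul_antidiag (hb : b 0 * b 2 < 0) :
    ((cayB b * Matrix.diagonal ![(1 : ℂ), 1, -(b 1 : ℂ) / (2 * (b 2 : ℂ))]).map (starRingEnd ℂ))ᵀ * Matrix.diagonal (fun i => (b i : ℂ)) *
        (cayB b * Matrix.diagonal ![(1 : ℂ), 1, -(b 1 : ℂ) / (2 * (b 2 : ℂ))]) =
      (b 1 : ℂ) • Matrix.of fun i j : Fin 3 => if i.val + j.val + 1 = 3 then (1 : ℂ) else 0 := by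
  have hb2 : (b 2 : ℂ) ≠ 0 := by
    have : b 2 ≠ 0 := fun h => by rw [h, mul_zero] at hb; exact lt_irrefl _ hb
    exact_mod_cast this
  have hr := sqrt_ratio_mul_self_mul hb
  set r : ℂ := (Real.sqrt (-b 2 / b 0) : ℂ) with hrdef
  have hrc : (starRingEnd ℂ) r = r := by rw [hrdef, Complex.conj_ofReal]
  set d : ℂ := -(b 1 : ℂ) / (2 * (b 2 : ℂ)) with hddef
  have hdc : (starRingEnd ℂ) d = d := by
    rw [hddef, map_div₀, map_neg, map_mul, Complex.conj_ofReal, Complex.conj_ofReal, map_ofNat]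
  have hd2 : d * (2 * (b 2 : ℂ)) = -(b 1 : ℂ) := by rw [hddef]; field_simp
  have hcay : cayB b = !![r, 0, r; 0, 1, 0; 1, 0, -1] := by rw [cayB, hrdef]
  rw [hcay]
  ext i j
  fin_cases i <;> fin_cases j <;>
    simp [Matrix.mul_apply, Fin.sum_univ_three, Matrix.diagonal, Matrix.of_apply, hrc, hdc, Matrix.vecHead, Matrix.vecTail]
  · linear_combination hr
  · linear_combination d * hr - hd2
  · linear_combination d * hr - hd2
  · linear_combination d * d * hr

/-- `det (cayB b · diag(v)) ≠ 0` for `b₀ b₂ < 0` and `v` with nonzero entries. [cite: Knapp1986, Ch. V §3] -/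
theorem det_cayB_mul_diagonal_ne_zero (hb : b 0 * b 2 < 0) {v : Fin 3 → ℂ} (hv : ∀ i, v i ≠ 0) : (cayB b * Matrix.diagonal v).det ≠ 0 := by
  rw [Matrix.det_mul, Matrix.det_diagonal]
  exact mul_ne_zero (det_cayB_ne_zero hb) (Finset.prod_ne_zero_iff.2 fun i _ => hv i)

/-- **The scaled boost frame diagonalises the boost**: `(cayB b · diag v) · diag(boostEig c) · (cayB b · diag v)⁻¹ = boostStd b c` (★ `boostStd_mul_cayB`; diagonal
matrices commute). [cite: Knapp1986, Ch. V §3] -/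
theorem boostFrame_conj_diagonal (hb : b 0 * b 2 < 0) {v : Fin 3 → ℂ} (hv : ∀ i, v i ≠ 0) (c : Fin 3 → ℝ) :
    cayB b * Matrix.diagonal v * Matrix.diagonal (boostEig c) * (cayB b * Matrix.diagonal v)⁻¹ = boostStd b c := by
  have hT : boostStd b c * (cayB b * Matrix.diagonal v) = cayB b * Matrix.diagonal v * Matrix.diagonal (boostEig c) := by
    rw [← Matrix.mul_assoc, boostStd_mul_cayB hb, Matrix.mul_assoc, Matrix.mul_assoc, Matrix.diagonal_mul_diagonal, Matrix.diagonal_mul_diagonal]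
    congr 2
    funext i
    exact mul_comm _ _
  rw [← hT, Matrix.mul_assoc, Matrix.mul_nonsing_inv _ ((Matrix.isUnit_iff_isUnit_det _).1 ?_), Matrix.mul_one]
  exact (Matrix.isUnit_iff_isUnit_det _).2 (det_cayB_mul_diagonal_ne_zero hb hv).isUnit

/-- `conj(e^{x+iθ}) · e^{−x+iθ} = 1`: the outer eigenvalues of the boost are `σ`-inverse to each other. [cite: Knapp1986, Ch. V §3] -/
theorem star_boostEig_zero_mul_boostEig_two (c : Fin 3 → ℝ) : star (boostEig c 0) * boostEig c 2 = 1 := by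
  simp only [boostEig, Matrix.cons_val_zero, Matrix.cons_val_two, Matrix.tail_cons, Matrix.head_cons]
  rw [Complex.star_def, ← Complex.exp_conj, ← Complex.exp_add, map_add, map_mul, Complex.conj_ofReal, Complex.conj_ofReal, Complex.conj_I]
  convert Complex.exp_zero using 2
  ring

/-- `boostEig c 2 = (conj (boostEig c 0))⁻¹`. [cite: Knapp1986, Ch. V §3] -/
theorem boostEig_two_eq_inv_star (c : Fin 3 → ℝ) : boostEig c 2 = (star (boostEig c 0))⁻¹ :=
  (eq_inv_of_mul_eq_one_right (star_boostEig_zero_mul_boostEig_two c)).symm ▸ rfl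

/-- **`diag(boostEig c) ∈ U(Φ₃)(ℂ)`** (`Φ₃ = antidiag(1,1,1)`): `conj(λ₀) λ₂ = 1`, `|λ₁| = 1` — the eigenvalue diagonal of the boost is a point of the split Cartan
`Z(γ₁)` of the model group. [cite: Rogawski1990, §3.6 p. 31] [cite: Knapp1986, Ch. V §3] -/
theorem mem_unitaryGroupOfForm_antidiag_of_coe_eq_diagonal_boostEig (c : Fin 3 → ℝ) {g : GL (Fin 3) ℂ}
    (hg : (g : Matrix (Fin 3) (Fin 3) ℂ) = Matrix.diagonal (boostEig c)) :
    g ∈ unitaryGroupOfForm (starRingEnd ℂ) (Matrix.of fun i j : Fin 3 => if i.val + j.val + 1 = 3 then (1 : ℂ) else 0) := by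
  have h02 : (starRingEnd ℂ) (boostEig c 0) * boostEig c 2 = 1 := star_boostEig_zero_mul_boostEig_two c
  have h20 : (starRingEnd ℂ) (boostEig c 2) * boostEig c 0 = 1 := by
    have := congrArg (starRingEnd ℂ) h02
    rwa [map_mul, Complex.conj_conj, map_one, mul_comm] at this
  have h11 : (starRingEnd ℂ) (boostEig c 1) * boostEig c 1 = 1 := by
    rw [← Complex.normSq_eq_conj_mul_self, Complex.normSq_eq_norm_sq]
    have : ‖boostEig c 1‖ = 1 := by simp [boostEig, Complex.norm_exp]
    rw [this]; norm_num
  rw [mem_unitaryGroupOfForm_iff, hg, Matrix.diagonal_map (map_zero _), Matrix.diagonal_transpose]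
  ext i j
  fin_cases i <;> fin_cases j <;> simp [Matrix.mul_apply, Fin.sum_univ_three, Matrix.diagonal, Matrix.of_apply, h02, h20, h11]

end Frame

/-! ## §2 The frame-generic compactness lemma for an `e`-diagonal boost chart -/

section Generic

/-- **HARISH-CHANDRA'S COMPACTNESS LEMMA FOR A CHART WHICH A FRAME DIAGONALISES TO `diag(boostEig ·)`.**  `G′` a topological group,
`e : U(Φ₃)(ℂ) ≃* G′` bicontinuous, `c : ℝ³ → G′` continuous with `e⁻¹(c cw) = diag(e^{x+iθ}, e^{iφ}, e^{−x+iθ})` (`cw = (x, φ, θ)`).  Then for `p 0 ≠ 0` the chart `c` is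
uniformly proper modulo `Z(c p)` on the regular set `{cw | cw 0 ≠ 0}`: ★ (W1-cont-Π) `uniformlyProper_centralizer_map_of_diag_hyperbolic` for `γ₁ = e⁻¹(c p)`
(`α₁ = e^{x₀+iθ₀}`, `|α₁| = e^{x₀} ≠ 1`), pulled back (★ `uniformlyProper_comp`) along `cw ↦ e⁻¹(c cw) ∈ Z(γ₁)` (`|t₀₀| = e^{x} ≠ 1 ⟺ x ≠ 0`).
[cite: Rogawski1990, §3.6 p. 31; §4.12 Lemma 4.12.1 p. 66; §8.2 pp. 122–123] [cite: HarishChandra1970, Part I §3 Lemma 22] [cite: Knapp1986, Ch. V §3] -/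
theorem uniformlyProper_of_frame_diag_boostEig {G' : Type*} [Group G'] [TopologicalSpace G']
    (e : ↥(unitaryGroupOfForm (starRingEnd ℂ) (Matrix.of fun i j : Fin 3 => if i.val + j.val + 1 = 3 then (1 : ℂ) else 0)) ≃* G')
    (he : Continuous e) (hes : Continuous e.symm) (c : (Fin 3 → ℝ) → G') (hc : Continuous c)
    (hdiag : ∀ cw, (((e.symm (c cw) : ↥(unitaryGroupOfForm (starRingEnd ℂ) (Matrix.of fun i j : Fin 3 => if i.val + j.val + 1 = 3 then (1 : ℂ) else 0))) :
      GL (Fin 3) ℂ) : Matrix (Fin 3) (Fin 3) ℂ) = Matrix.diagonal (boostEig cw))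
    (p : Fin 3 → ℝ) (hp : p 0 ≠ 0) :
    ∀ K ⊆ {cw : Fin 3 → ℝ | cw 0 ≠ 0}, IsCompact K → ∀ C : Set G', IsCompact C →
      ∃ 𝒦 : Set (G' ⧸ Subgroup.centralizer ({c p} : Set G')), IsCompact 𝒦 ∧
        ∀ cw ∈ K, ∀ y : G', y * c cw * y⁻¹ ∈ C → (QuotientGroup.mk y : G' ⧸ Subgroup.centralizer ({c p} : Set G')) ∈ 𝒦 := by
  set γ₁ := e.symm (c p) with hγ₁def
  have hγ₁ : ((γ₁ : GL (Fin 3) ℂ) : Matrix (Fin 3) (Fin 3) ℂ) = !![boostEig p 0, 0, 0; 0, boostEig p 1, 0; 0, 0, (star (boostEig p 0))⁻¹] := by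
    rw [hγ₁def, hdiag p, ← boostEig_two_eq_inv_star]
    ext i j
    fin_cases i <;> fin_cases j <;> simp [Matrix.diagonal]
  have hu₁ : ‖boostEig p 1‖ = 1 := by simp [boostEig, Complex.norm_exp]
  have hα₁1 : ‖boostEig p 0‖ ≠ 1 := by
    rw [show ‖boostEig p 0‖ = Real.exp (p 0) by simp [boostEig, Complex.norm_exp]]
    exact fun h => hp (Real.exp_eq_one_iff _ |>.1 h)
  have hcomm : ∀ cw, e.symm (c cw) ∈ Subgroup.centralizer ({γ₁} : Set _) := by
    intro cw
    rw [Subgroup.mem_centralizer_singleton_iff]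
    apply Subtype.ext
    apply Units.ext
    change ((e.symm (c cw) : GL (Fin 3) ℂ) : Matrix (Fin 3) (Fin 3) ℂ) * ((γ₁ : GL (Fin 3) ℂ) : Matrix (Fin 3) (Fin 3) ℂ) =
      ((γ₁ : GL (Fin 3) ℂ) : Matrix (Fin 3) (Fin 3) ℂ) * ((e.symm (c cw) : GL (Fin 3) ℂ) : Matrix (Fin 3) (Fin 3) ℂ)
    rw [hγ₁def, hdiag, hdiag, Matrix.diagonal_mul_diagonal, Matrix.diagonal_mul_diagonal]
    congr 1
    funext i
    exact mul_comm _ _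
  set d : (Fin 3 → ℝ) → ↥(Subgroup.centralizer ({γ₁} : Set _)) := fun cw => ⟨e.symm (c cw), hcomm cw⟩ with hddef
  have hd : Continuous d := (hes.comp hc).subtype_mk _
  have hS : Set.MapsTo d {cw : Fin 3 → ℝ | cw 0 ≠ 0}
      {t : ↥(Subgroup.centralizer ({γ₁} : Set ↥(unitaryGroupOfForm (starRingEnd ℂ) (Matrix.of fun i j : Fin 3 => if i.val + j.val + 1 = 3 then (1 : ℂ) else 0)))) |
        ‖((((t : ↥(Subgroup.centralizer ({γ₁} : Set _))) :
          ↥(unitaryGroupOfForm (starRingEnd ℂ) (Matrix.of fun i j : Fin 3 => if i.val + j.val + 1 = 3 then (1 : ℂ) else 0))) : GL (Fin 3) ℂ) : Matrix (Fin 3) (Fin 3) ℂ)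
          0 0‖ ≠ 1} := by
    intro cw hcw
    simp only [Set.mem_setOf_eq, hddef, hdiag, Matrix.diagonal_apply_eq]
    rw [show ‖boostEig cw 0‖ = Real.exp (cw 0) by simp [boostEig, Complex.norm_exp]]
    exact fun h => hcw (Real.exp_eq_one_iff _ |>.1 h)
  have H := uniformlyProper_comp (Subgroup.centralizer ({e γ₁} : Set G'))
    (fun t : ↥(Subgroup.centralizer ({γ₁} : Set _)) => e (t : ↥(unitaryGroupOfForm (starRingEnd ℂ) (Matrix.of fun i j : Fin 3 => if i.val + j.val + 1 = 3 then (1 : ℂ) else 0))))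
    (uniformlyProper_centralizer_map_of_diag_hyperbolic hγ₁ hu₁ hα₁1 e he hes) hd hS
  have h1 : ((fun t : ↥(Subgroup.centralizer ({γ₁} : Set _)) =>
      e (t : ↥(unitaryGroupOfForm (starRingEnd ℂ) (Matrix.of fun i j : Fin 3 => if i.val + j.val + 1 = 3 then (1 : ℂ) else 0)))) ∘ d) = c :=
    funext fun cw => e.apply_symm_apply (c cw)
  have h2 : e γ₁ = c p := e.apply_symm_apply (c p)
  rw [h1, h2] at H
  exact H

end Generic

/-! ## §3 The split block chart at a regular point: the `hsplit` binder -/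

section Place

variable (L : Type) [Field L] [NumberField L] [IsCMField L] (α : Fin 3 → L) (S' : Finset {w : InfinitePlace L // IsComplex w})

omit [NumberField L] [IsCMField L] in
/-- **(HYP) FOR THE SPLIT BLOCK CHART AT ITS REGULAR POINTS** — the per-place `hsplit` binder of ★ D4b-1 `uniformlyProper_gprimeTorus_of_semireg` ∕ ★ D4b-1β
`uniformlyProper_gprimeTorus_of_semireg_split`, discharged: at `w ∈ S♯ ∩ splitChartPlaces` and `p` with `p w 0 ≠ 0` (the split block of `p` is REGULAR), the chart
`cw ↦ gprimeBlock α w S♯ (fun _ ↦ cw)` is uniformly proper modulo `Z(gprimeBlock α w S♯ p)` on `{cw | cw 0 ≠ 0}` (the `w`-factor of ★ `RegG S♯`).  Proof: the boost frame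
`U(Φ₃)(ℂ) = U(b₁Φ₃) ≃[T = cayB b · diag(1,1,−b₁∕2b₂)] U(diag b) = U((diag a)∘τ) ≃[reindex τ] U(σ_w diag α)(ℂ) = G′_w` (`a = formRe`, `τ = lineOf (formSign)`, `b = a ∘ τ`)
carries `diag(boostEig cw)` to the block (§1), and §2 applies. [cite: Rogawski1990, §3.6 p. 31; §4.12 Lemma 4.12.1 p. 66; §8.2 pp. 122–123]
[cite: HarishChandra1970, Part I §3 Lemma 22] [cite: Knapp1986, Ch. V §3] [cite: PlatonovRapinchuk1994, §2.3] -/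
theorem uniformlyProper_gprimeBlock_split_of_ne_zero (hα : ∀ i, α i ≠ 0) {w : {w : InfinitePlace L // IsComplex w}} (hw : w ∈ S')
    (hsp : w ∈ splitChartPlaces L α) (p : {w : InfinitePlace L // IsComplex w} → Fin 3 → ℝ) (hx : p w 0 ≠ 0) :
    ∀ K ⊆ {cw : Fin 3 → ℝ | cw 0 ≠ 0}, IsCompact K → ∀ C : Set ↥(archLocal L 3 (Matrix.diagonal α) w), IsCompact C →
      ∃ 𝒦 : Set (↥(archLocal L 3 (Matrix.diagonal α) w) ⧸ Subgroup.centralizer ({gprimeBlock L α w S' p} : Set ↥(archLocal L 3 (Matrix.diagonal α) w))),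
        IsCompact 𝒦 ∧ ∀ cw ∈ K, ∀ y : ↥(archLocal L 3 (Matrix.diagonal α) w), y * gprimeBlock L α w S' (fun _ => cw) * y⁻¹ ∈ C →
          (QuotientGroup.mk y : ↥(archLocal L 3 (Matrix.diagonal α) w) ⧸ Subgroup.centralizer ({gprimeBlock L α w S' p} : Set ↥(archLocal L 3 (Matrix.diagonal α) w))) ∈ 𝒦 := by
  -- the place data: `a = formRe`, `τ = lineOf (formSign)`, `b = a ∘ τ` hyperbolic with `b₁ ≠ 0`
  set a : Fin 3 → ℝ := formRe L α w with hadef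
  set τ : Fin 3 ≃ Fin 3 := lineOf (formSign L α w) with hτdef
  have hb : (a ∘ τ) 0 * (a ∘ τ) 2 < 0 := hsp.2
  have hb1 : a (τ 1) ≠ 0 := formRe_ne_zero hα hsp.1 _
  have hb2 : a (τ 2) ≠ 0 := fun h => by rw [Function.comp_apply, Function.comp_apply, h, mul_zero] at hb; exact lt_irrefl _ hb
  have hε : ((a (τ 1) : ℝ) : ℂ) ≠ 0 := by exact_mod_cast hb1
  -- the scaled boost frame `T`
  set v : Fin 3 → ℂ := ![(1 : ℂ), 1, -((a ∘ τ) 1 : ℂ) / (2 * ((a ∘ τ) 2 : ℂ))] with hvdef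
  have hv : ∀ i, v i ≠ 0 := by
    intro i
    fin_cases i
    · simp [hvdef]
    · simp [hvdef]
    · simp only [hvdef, Function.comp_apply]
      exact div_ne_zero (neg_ne_zero.2 hε) (mul_ne_zero two_ne_zero (by exact_mod_cast hb2))
  set T : GL (Fin 3) ℂ := Matrix.GeneralLinearGroup.mkOfDetNeZero (cayB (a ∘ τ) * Matrix.diagonal v) (det_cayB_mul_diagonal_ne_zero hb hv) with hTdef
  have hTcoe : (T : Matrix (Fin 3) (Fin 3) ℂ) = cayB (a ∘ τ) * Matrix.diagonal v := by rw [hTdef, Matrix.GeneralLinearGroup.val_mkOfDetNeZero]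
  have hT : formCongr (starRingEnd ℂ) T (Matrix.diagonal fun i => ((a ∘ τ) i : ℂ)) =
      ((a ∘ τ) 1 : ℂ) • Matrix.of fun i j : Fin 3 => if i.val + j.val + 1 = 3 then (1 : ℂ) else 0 := by
    rw [formCongr, hTcoe, hvdef]
    exact formCongr_boostFrame_eq_smul_antidiag hb
  -- the three identifications of groups
  have hU0 : unitaryGroupOfForm (starRingEnd ℂ) (Matrix.of fun i j : Fin 3 => if i.val + j.val + 1 = 3 then (1 : ℂ) else 0) =
      unitaryGroupOfForm (starRingEnd ℂ) (((a ∘ τ) 1 : ℂ) • Matrix.of fun i j : Fin 3 => if i.val + j.val + 1 = 3 then (1 : ℂ) else 0) :=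
    (unitaryGroupOfForm_smul (starRingEnd ℂ) _ hε).symm
  have hU2 : unitaryGroupOfForm (starRingEnd ℂ) (Matrix.diagonal fun i => ((a ∘ τ) i : ℂ)) =
      unitaryGroupOfForm (starRingEnd ℂ) ((Matrix.diagonal fun i => (a i : ℂ)).submatrix τ τ) := by
    rw [Matrix.submatrix_diagonal_equiv]; rfl
  have hU3 : unitaryGroupOfForm (starRingEnd ℂ) (Matrix.diagonal fun i => (a i : ℂ)) = archLocal L 3 (Matrix.diagonal α) w := by
    show _ = unitaryGroupOfForm (starRingEnd ℂ) ((Matrix.diagonal α).map w.1.embedding)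
    rw [diagonal_map_embedding_eq_of_real hsp.1]
  have hcongr : ∀ {A B : Subgroup (GL (Fin 3) ℂ)} (h : A = B), Continuous (MulEquiv.subgroupCongr h) ∧ Continuous (MulEquiv.subgroupCongr h).symm := by
    intro A B h
    subst h
    exact ⟨continuous_induced_rng.2 continuous_subtype_val, continuous_induced_rng.2 continuous_subtype_val⟩
  -- the frame `e : U(Φ₃)(ℂ) ≃* G′_w`
  set e : ↥(unitaryGroupOfForm (starRingEnd ℂ) (Matrix.of fun i j : Fin 3 => if i.val + j.val + 1 = 3 then (1 : ℂ) else 0)) ≃* ↥(archLocal L 3 (Matrix.diagonal α) w) :=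
    (MulEquiv.subgroupCongr hU0).trans
      ((unitaryGroupOfFormCongrOfEq (starRingEnd ℂ) T _ _ hT).toMulEquiv.trans
        ((MulEquiv.subgroupCongr hU2).trans
          ((unitaryGroupOfFormReindex (starRingEnd ℂ) τ (Matrix.diagonal fun i => (a i : ℂ))).toMulEquiv.trans (MulEquiv.subgroupCongr hU3)))) with hedef
  have hecoe : ∀ g, (((e g : ↥(archLocal L 3 (Matrix.diagonal α) w)) : GL (Fin 3) ℂ) : Matrix (Fin 3) (Fin 3) ℂ) =
      Matrix.reindex τ τ ((T : Matrix (Fin 3) (Fin 3) ℂ) * ((g : GL (Fin 3) ℂ) : Matrix (Fin 3) (Fin 3) ℂ) * ((T⁻¹ : GL (Fin 3) ℂ) : Matrix (Fin 3) (Fin 3) ℂ)) :=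
    fun g => rfl
  have he : Continuous e := by
    rw [hedef]
    simp only [MulEquiv.coe_trans]
    exact (hcongr hU3).1.comp ((unitaryGroupOfFormReindex (starRingEnd ℂ) τ _).continuous.comp
      ((hcongr hU2).1.comp ((unitaryGroupOfFormCongrOfEq (starRingEnd ℂ) T _ _ hT).continuous.comp (hcongr hU0).1)))
  have hes : Continuous e.symm :=
    show Continuous fun x => (MulEquiv.subgroupCongr hU0).symm ((unitaryGroupOfFormCongrOfEq (starRingEnd ℂ) T _ _ hT).symm
        ((MulEquiv.subgroupCongr hU2).symm ((unitaryGroupOfFormReindex (starRingEnd ℂ) τ (Matrix.diagonal fun i => (a i : ℂ))).symm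
          ((MulEquiv.subgroupCongr hU3).symm x)))) from
      (hcongr hU0).2.comp ((unitaryGroupOfFormCongrOfEq (starRingEnd ℂ) T _ _ hT).symm.continuous.comp
        ((hcongr hU2).2.comp ((unitaryGroupOfFormReindex (starRingEnd ℂ) τ _).symm.continuous.comp (hcongr hU3).2)))
  -- the frame carries `diag(boostEig cw)` to the block
  have hblock : ∀ cw, e ⟨Matrix.GeneralLinearGroup.mkOfDetNeZero (Matrix.diagonal (boostEig cw))
      (by rw [Matrix.det_diagonal]; exact Finset.prod_ne_zero_iff.2 fun i _ => by fin_cases i <;> exact Complex.exp_ne_zero _),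
        mem_unitaryGroupOfForm_antidiag_of_coe_eq_diagonal_boostEig cw (Matrix.GeneralLinearGroup.val_mkOfDetNeZero _ _)⟩ =
      gprimeBlock L α w S' (fun _ => cw) := by
    intro cw
    apply Subtype.ext
    apply Units.ext
    rw [hecoe, coe_gprimeBlock_of_mem L α _ hw hsp, coe_gprimeSplitGL, gprimeSplitMatrix, Matrix.reindex_apply, Matrix.coe_units_inv, hTcoe,
      Matrix.GeneralLinearGroup.val_mkOfDetNeZero, boostFrame_conj_diagonal hb hv cw]
  have hdiag : ∀ cw, (((e.symm (gprimeBlock L α w S' (fun _ => cw)) :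
      ↥(unitaryGroupOfForm (starRingEnd ℂ) (Matrix.of fun i j : Fin 3 => if i.val + j.val + 1 = 3 then (1 : ℂ) else 0))) : GL (Fin 3) ℂ) : Matrix (Fin 3) (Fin 3) ℂ) =
        Matrix.diagonal (boostEig cw) := by
    intro cw
    rw [← hblock cw, MulEquiv.symm_apply_apply, Matrix.GeneralLinearGroup.val_mkOfDetNeZero]
  have hc : Continuous fun cw : Fin 3 → ℝ => gprimeBlock L α w S' (fun _ => cw) := by
    refine continuous_induced_rng.2 ?_
    have : (Subtype.val ∘ fun cw : Fin 3 → ℝ => gprimeBlock L α w S' (fun _ => cw)) = fun cw => gprimeSplitGL τ a cw :=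
      funext fun cw => coe_gprimeBlock_of_mem L α _ hw hsp
    rw [this]
    exact continuous_gprimeSplitGL τ a
  exact uniformlyProper_of_frame_diag_boostEig e he hes _ hc hdiag (p w) hx

end Place

/-! ## §4 The atlas: (HYP) for `gprimeTorus α S♯` on the regular set, and at a wall with all OTHER places regular -/

section Atlas

variable (L : Type) [Field L] [NumberField L] [IsCMField L] (α : Fin 3 → L) (S' : Finset {w : InfinitePlace L // IsComplex w})

/-- **`Z(gprimeTorus p) = Π_w Z(gprimeBlock p w)` under `archPiEquivCM`** (★ `mulEquiv_apply_mem_centralizer_singleton_iff`; the `hMM′` binder of ★ D4a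
`uniformlyProper_arch_of_places` for the atlas). [cite: Rogawski1990, §3.6 p. 31] -/
theorem symm_archPiEquivCM_mem_centralizer_gprimeTorus_iff (p : {w : InfinitePlace L // IsComplex w} → Fin 3 → ℝ)
    (g : ∀ w : {w : InfinitePlace L // IsComplex w}, ↥(archLocal L 3 (Matrix.diagonal α) w)) :
    (archPiEquivCM 3 L (Matrix.diagonal α)).symm g ∈
        Subgroup.centralizer ({gprimeTorus L α S' p} : Set ↥(arch (↥(maximalRealSubfield L)) L (IsCMField.complexConj L) 3 (Matrix.diagonal α))) ↔
      g ∈ Subgroup.pi Set.univ fun w => Subgroup.centralizer ({gprimeBlock L α w S' p} : Set ↥(archLocal L 3 (Matrix.diagonal α) w)) := by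
  rw [gprimeTorus, show ((archPiEquivCM 3 L (Matrix.diagonal α)).symm g) = (archPiEquivCM 3 L (Matrix.diagonal α)).symm.toMulEquiv g from rfl,
    show ((archPiEquivCM 3 L (Matrix.diagonal α)).symm fun w => gprimeBlock L α w S' p) =
      (archPiEquivCM 3 L (Matrix.diagonal α)).symm.toMulEquiv (fun w => gprimeBlock L α w S' p) from rfl,
    mulEquiv_apply_mem_centralizer_singleton_iff, Subgroup.mem_centralizer_singleton_iff, Subgroup.mem_pi]
  simp only [Set.mem_univ, true_imp_iff, Subgroup.mem_centralizer_singleton_iff]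
  exact ⟨fun h w => congrFun h w, fun h => funext h⟩

/-- **HARISH-CHANDRA'S COMPACTNESS LEMMA FOR THE ATLAS ON THE REGULAR SET** ((HYP) form, NO wall): `p` regular at every split-chart place of `S♯` (`p w 0 ≠ 0`),
per-place parameter sets `S w ⊆ {cw 0 ≠ 0}` there and `S w ⊆ {injective angles}` at the compact-chart places (so `Set.pi univ S ⊇` every compact of ★ `RegG S♯`
shape).  Then `c ↦ gprimeTorus α S♯ c` is uniformly proper modulo `Z(gprimeTorus α S♯ p)` on `Set.pi univ S` (§3 + ★ D4b-1 `uniformlyProper_gprimeBlock_cpt_of_injective`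
+ ★ D4a). [cite: Rogawski1990, §4.12 Lemma 4.12.1 p. 66; §8.2 p. 114] [cite: HarishChandra1970, Part I §3 Lemma 22] [cite: Shelstad1979, §4 p. 25] -/
theorem uniformlyProper_gprimeTorus_of_regular (hα : ∀ i, α i ≠ 0) (p : {w : InfinitePlace L // IsComplex w} → Fin 3 → ℝ)
    (hp : ∀ w, w ∈ S' ∧ w ∈ splitChartPlaces L α → p w 0 ≠ 0)
    (S : {w : InfinitePlace L // IsComplex w} → Set (Fin 3 → ℝ))
    (hScpt : ∀ w, ¬ (w ∈ S' ∧ w ∈ splitChartPlaces L α) → S w ⊆ {cw : Fin 3 → ℝ | Function.Injective fun i : Fin 3 => Circle.exp (cw i)})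
    (hSsplit : ∀ w, w ∈ S' ∧ w ∈ splitChartPlaces L α → S w ⊆ {cw : Fin 3 → ℝ | cw 0 ≠ 0}) :
    ∀ K ⊆ Set.pi Set.univ S, IsCompact K → ∀ C' : Set ↥(arch (↥(maximalRealSubfield L)) L (IsCMField.complexConj L) 3 (Matrix.diagonal α)), IsCompact C' →
      ∃ 𝒦' : Set (↥(arch (↥(maximalRealSubfield L)) L (IsCMField.complexConj L) 3 (Matrix.diagonal α)) ⧸ Subgroup.centralizer ({gprimeTorus L α S' p} : Set ↥(arch (↥(maximalRealSubfield L)) L (IsCMField.complexConj L) 3 (Matrix.diagonal α)))),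
        IsCompact 𝒦' ∧ ∀ c ∈ K, ∀ y' : ↥(arch (↥(maximalRealSubfield L)) L (IsCMField.complexConj L) 3 (Matrix.diagonal α)), y' * gprimeTorus L α S' c * y'⁻¹ ∈ C' →
          (QuotientGroup.mk y' : ↥(arch (↥(maximalRealSubfield L)) L (IsCMField.complexConj L) 3 (Matrix.diagonal α)) ⧸ Subgroup.centralizer ({gprimeTorus L α S' p} : Set ↥(arch (↥(maximalRealSubfield L)) L (IsCMField.complexConj L) 3 (Matrix.diagonal α)))) ∈ 𝒦' := by
  have hprop : ∀ w : {w : InfinitePlace L // IsComplex w}, ∀ K ⊆ S w, IsCompact K → ∀ C : Set ↥(archLocal L 3 (Matrix.diagonal α) w), IsCompact C →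
      ∃ 𝒦 : Set (↥(archLocal L 3 (Matrix.diagonal α) w) ⧸ Subgroup.centralizer ({gprimeBlock L α w S' p} : Set ↥(archLocal L 3 (Matrix.diagonal α) w))),
        IsCompact 𝒦 ∧ ∀ cw ∈ K, ∀ y : ↥(archLocal L 3 (Matrix.diagonal α) w), y * gprimeBlock L α w S' (fun _ => cw) * y⁻¹ ∈ C →
          (QuotientGroup.mk y : ↥(archLocal L 3 (Matrix.diagonal α) w) ⧸ Subgroup.centralizer ({gprimeBlock L α w S' p} : Set ↥(archLocal L 3 (Matrix.diagonal α) w))) ∈ 𝒦 := by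
    intro w
    by_cases hws : w ∈ S' ∧ w ∈ splitChartPlaces L α
    · exact uniformlyProper_mono _ _ (hSsplit w hws) (uniformlyProper_gprimeBlock_split_of_ne_zero L α S' hα hws.1 hws.2 p (hp w hws))
    · exact uniformlyProper_mono _ _ (hScpt w hws) (uniformlyProper_gprimeBlock_cpt_of_injective L α S' hα hws _)
  exact uniformlyProper_arch_of_places L 3 (Matrix.diagonal α) (fun w => Subgroup.centralizer ({gprimeBlock L α w S' p} : Set ↥(archLocal L 3 (Matrix.diagonal α) w)))
    (Subgroup.centralizer ({gprimeTorus L α S' p} : Set _)) (symm_archPiEquivCM_mem_centralizer_gprimeTorus_iff L α S' p)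
    (fun w cw => gprimeBlock L α w S' (fun _ => cw)) S hprop

/-- **Group-level form on the regular set**: ONE compact `C″ ⊆ G′_∞` with `y′ ∈ C″ · Z(gprimeTorus p)` whenever `y′ · gprimeTorus c · y′⁻¹ ∈ C′`, `c ∈ K` — the
uniform `hCM` binder of ★ D4b-2 `exists_descended_chartOrbG_eq` ∕ `chartOrbG_eq_integral_descended_of_cutoff` at a regular base point.
[cite: Rogawski1990, §4.12 Lemma 4.12.1 p. 66; §8.2 p. 114] [cite: DeitmarEchterhoff2014, Remark 1.5.2] -/
theorem exists_isCompact_mul_gprimeTorus_of_regular (hα : ∀ i, α i ≠ 0) (p : {w : InfinitePlace L // IsComplex w} → Fin 3 → ℝ)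
    (hp : ∀ w, w ∈ S' ∧ w ∈ splitChartPlaces L α → p w 0 ≠ 0)
    (S : {w : InfinitePlace L // IsComplex w} → Set (Fin 3 → ℝ))
    (hScpt : ∀ w, ¬ (w ∈ S' ∧ w ∈ splitChartPlaces L α) → S w ⊆ {cw : Fin 3 → ℝ | Function.Injective fun i : Fin 3 => Circle.exp (cw i)})
    (hSsplit : ∀ w, w ∈ S' ∧ w ∈ splitChartPlaces L α → S w ⊆ {cw : Fin 3 → ℝ | cw 0 ≠ 0})
    {K : Set ({w : InfinitePlace L // IsComplex w} → Fin 3 → ℝ)} (hKS : K ⊆ Set.pi Set.univ S) (hK : IsCompact K)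
    {C' : Set ↥(arch (↥(maximalRealSubfield L)) L (IsCMField.complexConj L) 3 (Matrix.diagonal α))} (hC' : IsCompact C') :
    ∃ C'' : Set ↥(arch (↥(maximalRealSubfield L)) L (IsCMField.complexConj L) 3 (Matrix.diagonal α)), IsCompact C'' ∧ ∀ c ∈ K, ∀ y' : ↥(arch (↥(maximalRealSubfield L)) L (IsCMField.complexConj L) 3 (Matrix.diagonal α)), y' * gprimeTorus L α S' c * y'⁻¹ ∈ C' →
      y' ∈ (C'' * (Subgroup.centralizer ({gprimeTorus L α S' p} : Set ↥(arch (↥(maximalRealSubfield L)) L (IsCMField.complexConj L) 3 (Matrix.diagonal α)))) : Set ↥(arch (↥(maximalRealSubfield L)) L (IsCMField.complexConj L) 3 (Matrix.diagonal α))) := by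
  obtain ⟨𝒦', h𝒦', hmem⟩ := uniformlyProper_gprimeTorus_of_regular L α S' hα p hp S hScpt hSsplit K hKS hK C' hC'
  obtain ⟨C'', hC'', hsub⟩ := exists_isCompact_image_mk_superset (Subgroup.centralizer ({gprimeTorus L α S' p} : Set ↥(arch (↥(maximalRealSubfield L)) L (IsCMField.complexConj L) 3 (Matrix.diagonal α)))) h𝒦'
  refine ⟨C'', hC'', fun c hc y' hy' => ?_⟩
  obtain ⟨a, ha, hay⟩ := hsub (hmem c hc y' hy')
  rw [QuotientGroup.eq] at hay
  exact ⟨a, ha, a⁻¹ * y', hay, by group⟩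

/-- **(HYP) for the atlas at a COMPACT-CHART wall place `w₀`, all other places regular** — ★ D4b-1 `uniformlyProper_gprimeTorus_of_semireg` with its `hsplit` binder
discharged by §3 (`p w 0 ≠ 0` and `S w ⊆ {cw 0 ≠ 0}` at the split-chart places of `S♯`). [cite: Rogawski1990, §4.12 Lemma 4.12.1 p. 66; §8.2 p. 114]
[cite: HarishChandra1970, Part I §3 Lemma 22] [cite: Shelstad1979, §4 p. 25] -/
theorem uniformlyProper_gprimeTorus_of_semireg_of_regular (hα : ∀ i, α i ≠ 0)
    (hreal : ∀ (w : {w : InfinitePlace L // IsComplex w}) (i : Fin 3), (w.1.embedding (α i)).im = 0)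
    (p : {w : InfinitePlace L // IsComplex w} → Fin 3 → ℝ) (w₀ : {w : InfinitePlace L // IsComplex w}) (hw₀ : ¬ (w₀ ∈ S' ∧ w₀ ∈ splitChartPlaces L α)) (k₀ : Fin 3)
    (hwall : ∀ j j', j ≠ k₀ → j' ≠ k₀ → Circle.exp (p w₀ j) = Circle.exp (p w₀ j'))
    (hp : ∀ w, w ∈ S' ∧ w ∈ splitChartPlaces L α → p w 0 ≠ 0)
    (S : {w : InfinitePlace L // IsComplex w} → Set (Fin 3 → ℝ))
    (hS₀ : S w₀ ⊆ {cw : Fin 3 → ℝ | ∀ j, j ≠ k₀ → Circle.exp (cw k₀) ≠ Circle.exp (cw j)})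
    (hScpt : ∀ w, w ≠ w₀ → ¬ (w ∈ S' ∧ w ∈ splitChartPlaces L α) → S w ⊆ {cw : Fin 3 → ℝ | Function.Injective fun i : Fin 3 => Circle.exp (cw i)})
    (hSsplit : ∀ w, w ∈ S' ∧ w ∈ splitChartPlaces L α → S w ⊆ {cw : Fin 3 → ℝ | cw 0 ≠ 0}) :
    ∀ K ⊆ Set.pi Set.univ S, IsCompact K → ∀ C' : Set ↥(arch (↥(maximalRealSubfield L)) L (IsCMField.complexConj L) 3 (Matrix.diagonal α)), IsCompact C' →
      ∃ 𝒦' : Set (↥(arch (↥(maximalRealSubfield L)) L (IsCMField.complexConj L) 3 (Matrix.diagonal α)) ⧸ Subgroup.centralizer ({gprimeTorus L α S' p} : Set ↥(arch (↥(maximalRealSubfield L)) L (IsCMField.complexConj L) 3 (Matrix.diagonal α)))),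
        IsCompact 𝒦' ∧ ∀ c ∈ K, ∀ y' : ↥(arch (↥(maximalRealSubfield L)) L (IsCMField.complexConj L) 3 (Matrix.diagonal α)), y' * gprimeTorus L α S' c * y'⁻¹ ∈ C' →
          (QuotientGroup.mk y' : ↥(arch (↥(maximalRealSubfield L)) L (IsCMField.complexConj L) 3 (Matrix.diagonal α)) ⧸ Subgroup.centralizer ({gprimeTorus L α S' p} : Set ↥(arch (↥(maximalRealSubfield L)) L (IsCMField.complexConj L) 3 (Matrix.diagonal α)))) ∈ 𝒦' :=
  uniformlyProper_gprimeTorus_of_semireg L α S' hα hreal p w₀ hw₀ k₀ hwall S hS₀ hScpt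
    fun w hws => uniformlyProper_mono _ _ (hSsplit w hws) (uniformlyProper_gprimeBlock_split_of_ne_zero L α S' hα hws.1 hws.2 p (hp w hws))

/-- **(HYP) for the atlas at the REAL WALL of a split-chart place `w₀ ∈ S♯` (`p w₀ 0 = 0`), all other places regular** — ★ D4b-1β
`uniformlyProper_gprimeTorus_of_semireg_split` with its `hsplit` binder discharged by §3.  The (G′-CAY) configuration: the limit `x → 0` at `w₀` runs inside
`RegG S♯` at the other places (group-level form: ★ `exists_isCompact_mul_gprimeTorus_of_semireg_split` with the same one-line discharge of `hsplit`).
[cite: Rogawski1990, §4.12 Lemma 4.12.1 p. 66; §8.2 pp. 114, 122–123] [cite: HarishChandra1970, Part I §3 Lemma 22] -/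
theorem uniformlyProper_gprimeTorus_of_semireg_split_of_regular (hα : ∀ i, α i ≠ 0)
    (p : {w : InfinitePlace L // IsComplex w} → Fin 3 → ℝ) (w₀ : {w : InfinitePlace L // IsComplex w}) (hw₀ : w₀ ∈ S') (hsp₀ : w₀ ∈ splitChartPlaces L α)
    (hx : p w₀ 0 = 0) (hp : ∀ w, w ≠ w₀ → w ∈ S' ∧ w ∈ splitChartPlaces L α → p w 0 ≠ 0)
    (S : {w : InfinitePlace L // IsComplex w} → Set (Fin 3 → ℝ))
    (hS₀ : S w₀ ⊆ {cw : Fin 3 → ℝ | ∀ j, j ≠ 1 → boostEig cw 1 ≠ boostEig cw j})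
    (hScpt : ∀ w, ¬ (w ∈ S' ∧ w ∈ splitChartPlaces L α) → S w ⊆ {cw : Fin 3 → ℝ | Function.Injective fun i : Fin 3 => Circle.exp (cw i)})
    (hSsplit : ∀ w, w ≠ w₀ → w ∈ S' ∧ w ∈ splitChartPlaces L α → S w ⊆ {cw : Fin 3 → ℝ | cw 0 ≠ 0}) :
    ∀ K ⊆ Set.pi Set.univ S, IsCompact K → ∀ C' : Set ↥(arch (↥(maximalRealSubfield L)) L (IsCMField.complexConj L) 3 (Matrix.diagonal α)), IsCompact C' →
      ∃ 𝒦' : Set (↥(arch (↥(maximalRealSubfield L)) L (IsCMField.complexConj L) 3 (Matrix.diagonal α)) ⧸ Subgroup.centralizer ({gprimeTorus L α S' p} : Set ↥(arch (↥(maximalRealSubfield L)) L (IsCMField.complexConj L) 3 (Matrix.diagonal α)))),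
        IsCompact 𝒦' ∧ ∀ c ∈ K, ∀ y' : ↥(arch (↥(maximalRealSubfield L)) L (IsCMField.complexConj L) 3 (Matrix.diagonal α)), y' * gprimeTorus L α S' c * y'⁻¹ ∈ C' →
          (QuotientGroup.mk y' : ↥(arch (↥(maximalRealSubfield L)) L (IsCMField.complexConj L) 3 (Matrix.diagonal α)) ⧸ Subgroup.centralizer ({gprimeTorus L α S' p} : Set ↥(arch (↥(maximalRealSubfield L)) L (IsCMField.complexConj L) 3 (Matrix.diagonal α)))) ∈ 𝒦' :=
  uniformlyProper_gprimeTorus_of_semireg_split L α S' hα p w₀ hw₀ hsp₀ hx S hS₀ hScpt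
    fun w hw hws => uniformlyProper_mono _ _ (hSsplit w hw hws) (uniformlyProper_gprimeBlock_split_of_ne_zero L α S' hα hws.1 hws.2 p (hp w hw hws))

end Atlas

end Literature.NumberTheory.Rogawski1990

end
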